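import Mathlib
import Summits.KontsevichZagierPeriods.Zeta5Search.CollinearityGuard
import Summits.KontsevichZagierPeriods.Zeta5Search.LemmaDBonusProof
import HarnessLib

/-!
# ζ(5) search — census g17's ORBIT-TYPE COROLLARY: the structural guard `ccGuard` / `ccGuardT` licenses `casLB + 1` (rungs O / X)

Cell `pub-zeta5` (HONEST FRAMING: systematic search; no irrationality claim unless certified), typer seat generation 10.
Answers census g17's REQUEST (INBOX 2026-08-20T18:16Z (b), `xsave/g17/bc17/CCGuard.lean`): `ccOrbitTypeCorollary` is census's
`CCOrbitTypeCorollary` VERBATIM as a theorem — in the window, from the structural count `k = ccCount b p N` of orbit types among the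
non-vanishing deep classes, `k ≤ 1` gives a line THROUGH THE ORIGIN containing every deep orbit vector `(P_K(x), P_V(x))` (mod `p`), and `N` odd,
`k = 2` gives an AFFINE line — the hypothesis `hline` of `CollinearityCriterion(T)`.  With `collinearityCriterion_holds` /
`collinearityCriterionT_holds` (typer g10) this yields the rung licences `casLB_succ_le_of_ccGuard` (rung O) and `casLB_succ_le_of_ccGuardT` (rung X):
`ccGuard b p N = true` (resp. `ccGuardT`) ⇒ `casLB b p + 1 ≤ v_p(Cas_j(b))`.

PROOF.  (§1) A deep class outside `ccLive` (centre-free, `N` even, palindromic level vector) has orbit vector `0`: its conjugate has the same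
exponent function, hence the same `σ_K`, `v̂` (`typeData_eq`), and `s = (−1)^{N+1} = −1`.  Two deep classes with `sameKey` keys have equal
orbit vectors, or opposite ones up to the factor `s` (equal level vectors: equal data for them and their conjugates; reversed: `y` has the data
of `x̄` and `ȳ` those of `x`, `s² = 1`; two centre classes coincide).  (§2) `keyCount_cover` turns `k ≤ 1` into "all live keys related" (orbit
vectors in `{0, P₀, sP₀}`: line `(V₀, −K₀)` or `(1, 0)` through `0`) and `k = 2`, `N` odd (`s = 1`, every deep class live) into "orbit vectors in
`{P₁, P₂}`" (the affine line through them, `e` allowed by the moment range).  Nothing here bears on irrationality.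
-/

noncomputable section

open Finset

namespace Summit.KontsevichZagierPeriods.Zeta5Search.ClusterValuation

open Summit.KontsevichZagierPeriods.Zeta5Search.DualSeries (InBox)
open Summit.KontsevichZagierPeriods.Zeta5Search.WedgeDictionary (dOf)
open Summit.KontsevichZagierPeriods.Zeta5Search.CasoratianValuation (InPolytope shift casoratian)
open Summit.KontsevichZagierPeriods.Zeta5Search.PadicSeries
open Summit.KontsevichZagierPeriods.Zeta5Search.CellKit (conj_level netExp_conj_level)

variable {p : ℕ} [hp : Fact p.Prime]

/-! ## §1  Orbit vectors from the structural key -/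

section Orbits

variable (b : ℕ → ℤ) (hb : InPolytope b) (hp5 : 5 ≤ p) (hpb : (p : ℤ) ≤ b 0) (hwin : (b 0 + 2 : ℤ) < (p : ℤ) ^ 2) {N : ℕ}
include hb hp5 hpb hwin

/-- **A deep class outside `ccLive` has orbit vector `0` in `ZMod p`.** -/
theorem orbit_cast_eq_zero_of_not_live {x : ℕ} (hxD : x ∈ deepClasses b p N) (hxl : x ∉ ccLive b p N) :
    ((orbitK b p N x : ℚ) : ZMod p) = 0 ∧ ((orbitV b p N x : ℚ) : ZMod p) = 0 := by
  have hprime := hp.out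
  have hp0 : 0 < p := hprime.pos
  have h0 : 0 ≤ b 0 := hb.1.1
  obtain ⟨-, -, -, hnp2⟩ := thmA_data b hb hwin
  have hp2 : p ≠ 2 := by omega
  set n := (b 0).toNat with hn
  have hpn : p ≤ n := by omega
  obtain ⟨hxr, hE⟩ := mem_filter.1 hxD
  have hx := mem_range.1 hxr
  have hxn : x ≤ n := by omega
  have hdead : ¬ CentreIn b p x ∧ N % 2 = 0 ∧ levelVec b p x = (levelVec b p x).reverse := by
    by_contra h
    exact hxl (mem_ccLive_iff.2 ⟨hxD, h⟩)
  obtain ⟨hcx, hN2, hpalv⟩ := hdead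
  obtain ⟨L, hL, hL'⟩ := exists_level b hp0 hxn
  have hpal : ∀ k ≤ L, netExp b (x + k * p) = netExp b (x + (L - k) * p) := by
    have h := hpalv
    rw [levelVec_level b hx hL hL', map_range_reverse] at h
    exact (levelData_of_map_eq h).2
  obtain ⟨hx', hM, hM'⟩ := conj_level b hx hL hL'
  have hcc : ¬ CentreIn b p (conjClass b p x) := fun h => hcx ((centreIn_conj_iff b h0 hxn).1 h)
  have hex : ∀ k ≤ L, netExp b (conjClass b p x + k * p) = netExp b (x + k * p) := by
    intro k hk
    rw [netExp_conj_level b hL hL' h0 hk, ← hpal k hk]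
  obtain ⟨hc_eq, hv_eq, hn_eq, -⟩ := typeData_eq b hx' hM hM' hx hL hL' hcc hcx hex
  have hs1 : (-1 : ZMod p) ^ (N + 1) = -1 :=
    Odd.neg_one_pow (Nat.even_iff.2 hN2).add_one
  refine ⟨?_, ?_⟩
  · rw [cast_orbitK b h0 hnp2 hp2 N x, if_neg hcx, sigmaK_eq_of_typeData hc_eq hn_eq, hs1]; ring
  · rw [cast_orbitV b h0 hnp2 hp2 N x, if_neg hcx, hv_eq, hs1]; ring

/-- **Two deep classes with the same key have equal orbit vectors, up to the sign `s = (−1)^{N+1}`.** -/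
theorem orbit_cast_of_sameKey {x y : ℕ} (hxD : x ∈ deepClasses b p N) (hyD : y ∈ deepClasses b p N)
    (hkey : sameKey (decide (CentreIn b p y), levelVec b p y) (decide (CentreIn b p x), levelVec b p x) = true) :
    (((orbitK b p N y : ℚ) : ZMod p) = ((orbitK b p N x : ℚ) : ZMod p) ∧
      ((orbitV b p N y : ℚ) : ZMod p) = ((orbitV b p N x : ℚ) : ZMod p)) ∨
    (((orbitK b p N y : ℚ) : ZMod p) = (-1 : ZMod p) ^ (N + 1) * ((orbitK b p N x : ℚ) : ZMod p) ∧
      ((orbitV b p N y : ℚ) : ZMod p) = (-1 : ZMod p) ^ (N + 1) * ((orbitV b p N x : ℚ) : ZMod p)) := by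
  have hprime := hp.out
  have hp0 : 0 < p := hprime.pos
  have h0 : 0 ≤ b 0 := hb.1.1
  obtain ⟨-, -, -, hnp2⟩ := thmA_data b hb hwin
  have hp2 : p ≠ 2 := by omega
  set n := (b 0).toNat with hn
  have hpn : p ≤ n := by omega
  obtain ⟨hxr, hEx⟩ := mem_filter.1 hxD
  obtain ⟨hyr, hEy⟩ := mem_filter.1 hyD
  have hx := mem_range.1 hxr
  have hy := mem_range.1 hyr
  have hxn : x ≤ n := by omega
  have hyn : y ≤ n := by omega
  simp only [sameKey, Bool.and_eq_true, Bool.or_eq_true, beq_iff_eq, Bool.not_eq_true', decide_eq_decide,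
    decide_eq_false_iff_not] at hkey
  obtain ⟨hciff, hvec⟩ := hkey
  set s : ZMod p := (-1 : ZMod p) ^ (N + 1) with hs
  have hss : s * s = 1 := by
    simp only [hs]; rw [← pow_add]; exact Even.neg_one_pow ⟨N + 1, rfl⟩
  by_cases hc : CentreIn b p x
  · have hxy : y = x := eq_of_centreIn b hp5 hy hx (hciff.2 hc) hc
    subst hxy
    exact Or.inl ⟨rfl, rfl⟩
  · have hcy : ¬ CentreIn b p y := fun h => hc (hciff.1 h)
    obtain ⟨L, hL, hL'⟩ := exists_level b hp0 hxn
    obtain ⟨L', hLy, hLy'⟩ := exists_level b hp0 hyn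
    have hevx := levelVec_level b hx hL hL'
    have hevy := levelVec_level b hy hLy hLy'
    obtain ⟨hx', hLc, hLc'⟩ := conj_level b hx hL hL'
    have hccx : ¬ CentreIn b p (conjClass b p x) := fun h => hc ((centreIn_conj_iff b h0 hxn).1 h)
    have hccy : ¬ CentreIn b p (conjClass b p y) := fun h => hcy ((centreIn_conj_iff b h0 hyn).1 h)
    rcases hvec with hsame | ⟨-, hrevd⟩
    · -- equal level vectors
      rw [hevx, hevy] at hsame
      obtain ⟨hLL, he⟩ := levelData_of_map_eq hsame
      subst hLL
      obtain ⟨hy', hLyc, hLyc'⟩ := conj_level b hy hLy hLy'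
      obtain ⟨hc1, hv1, hn1, -⟩ := typeData_eq b hy hLy hLy' hx hL hL' hcy hc he
      have hec : ∀ k ≤ L', netExp b (conjClass b p y + k * p) = netExp b (conjClass b p x + k * p) := by
        intro k hk
        rw [netExp_conj_level b hLy hLy' h0 hk, netExp_conj_level b hL hL' h0 hk, he (L' - k) (Nat.sub_le _ _)]
      obtain ⟨hc2, hv2, hn2, -⟩ := typeData_eq b hy' hLyc hLyc' hx' hLc hLc' hccy hccx hec
      left
      constructor
      · rw [cast_orbitK b h0 hnp2 hp2 N y, cast_orbitK b h0 hnp2 hp2 N x, if_neg hcy, if_neg hc,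
          sigmaK_eq_of_typeData hc1 hn1, sigmaK_eq_of_typeData hc2 hn2]
      · rw [cast_orbitV b h0 hnp2 hp2 N y, cast_orbitV b h0 hnp2 hp2 N x, if_neg hcy, if_neg hc, hv1, hv2]
    · -- reversed level vectors: `y` carries the data of `x̄`, and `ȳ` those of `x`
      rw [hevx, hevy, map_range_reverse] at hrevd
      obtain ⟨hLL, he⟩ := levelData_of_map_eq hrevd
      subst hLL
      obtain ⟨hy', hLyc, hLyc'⟩ := conj_level b hy hLy hLy'
      have he1 : ∀ k ≤ L', netExp b (y + k * p) = netExp b (conjClass b p x + k * p) := by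
        intro k hk
        rw [netExp_conj_level b hL hL' h0 hk, he k hk]
      obtain ⟨hc1, hv1, hn1, -⟩ := typeData_eq b hy hLy hLy' hx' hLc hLc' hcy hccx he1
      have he2 : ∀ k ≤ L', netExp b (conjClass b p y + k * p) = netExp b (x + k * p) := by
        intro k hk
        rw [netExp_conj_level b hLy hLy' h0 hk, he (L' - k) (Nat.sub_le _ _), Nat.sub_sub_self hk]
      obtain ⟨hc2, hv2, hn2, -⟩ := typeData_eq b hy' hLyc hLyc' hx hL hL' hccy hc he2
      right
      constructor
      · rw [cast_orbitK b h0 hnp2 hp2 N y, cast_orbitK b h0 hnp2 hp2 N x, if_neg hcy, if_neg hc,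
          sigmaK_eq_of_typeData hc1 hn1, sigmaK_eq_of_typeData hc2 hn2, ← hs]
        linear_combination (-(((sigmaK b p (conjClass b p x) : ℚ) : ZMod p))) * hss
      · rw [cast_orbitV b h0 hnp2 hp2 N y, cast_orbitV b h0 hnp2 hp2 N x, if_neg hcy, if_neg hc, hv1, hv2, ← hs]
        linear_combination (-(((vHat b p (conjClass b p x) : ℚ) : ZMod p))) * hss

omit hpb in
/-- Integrality and reading of the line relation: `a·K̄(x) + c·V̄(x) + e = 0` in `ZMod p` gives the `pCong` of the hypothesis `hline`. -/
theorem pCong_line_of_cast (a c e : ℤ) (x : ℕ)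
    (h : (a : ZMod p) * ((orbitK b p N x : ℚ) : ZMod p) + (c : ZMod p) * ((orbitV b p N x : ℚ) : ZMod p) + (e : ZMod p) = 0) :
    pCong p (a * orbitK b p N x + c * orbitV b p N x + e) = true := by
  have h0 : 0 ≤ b 0 := hb.1.1
  obtain ⟨-, -, -, hnp2⟩ := thmA_data b hb hwin
  have hp2 : p ≠ 2 := by omega
  have hdK := den_orbitK b h0 hnp2 hp2 N x
  have hdV := den_orbitV b h0 hnp2 hp2 N x
  have hden : ¬ p ∣ ((a : ℚ) * orbitK b p N x + c * orbitV b p N x + (e : ℚ)).den :=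
    PInt.add (PInt.add (PInt.mul (PInt.intCast a) hdK) (PInt.mul (PInt.intCast c) hdV)) (PInt.intCast e)
  refine PInt.pCong_of_cast_eq_zero hden ?_
  rw [PInt.cast_add (PInt.add (PInt.mul (PInt.intCast a) hdK) (PInt.mul (PInt.intCast c) hdV)) (PInt.intCast e),
    PInt.cast_add (PInt.mul (PInt.intCast a) hdK) (PInt.mul (PInt.intCast c) hdV),
    PInt.cast_mul (PInt.intCast a) hdK, PInt.cast_mul (PInt.intCast c) hdV, Rat.cast_intCast, Rat.cast_intCast,
    Rat.cast_intCast]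
  exact h

/-! ## §2  The lines -/

/-- **`k ≤ 1`: a line through the origin.** -/
theorem line_origin_of_ccCount_le_one (hk : ccCount b p N ≤ 1) :
    ∃ a c : ℤ, ¬ ((p : ℤ) ∣ a ∧ (p : ℤ) ∣ c) ∧
      ∀ x ∈ deepClasses b p N, pCong p (a * orbitK b p N x + c * orbitV b p N x + ((0 : ℤ) : ℚ)) = true := by
  classical
  have hprime := hp.out
  have hone : ¬ ((p : ℤ) ∣ 1) := fun h => by have := Int.le_of_dvd one_pos h; omega
  have ev : ∀ z : ZMod p, (((z.val : ℕ) : ℤ) : ZMod p) = z := fun z => by rw [Int.cast_natCast, ZMod.natCast_zmod_val]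
  -- all live keys are related
  have hrel : ∀ x ∈ ccLive b p N, ∀ y ∈ ccLive b p N,
      sameKey (decide (CentreIn b p y), levelVec b p y) (decide (CentreIn b p x), levelVec b p x) = true := by
    intro x hx y hy
    unfold ccCount at hk
    exact sameKey_of_keyCount_le_one hk _ (List.mem_map.2 ⟨y, hy, rfl⟩) _ (List.mem_map.2 ⟨x, hx, rfl⟩)
  by_cases hlive : ∃ x₀, x₀ ∈ ccLive b p N
  · obtain ⟨x₀, hx₀⟩ := hlive
    have hx₀D : x₀ ∈ deepClasses b p N := (mem_ccLive_iff.1 hx₀).1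
    -- every deep orbit vector is `0`, `P₀` or `s P₀`
    have hall : ∀ x ∈ deepClasses b p N,
        (((orbitK b p N x : ℚ) : ZMod p) = 0 ∧ ((orbitV b p N x : ℚ) : ZMod p) = 0) ∨
        (((orbitK b p N x : ℚ) : ZMod p) = ((orbitK b p N x₀ : ℚ) : ZMod p) ∧
          ((orbitV b p N x : ℚ) : ZMod p) = ((orbitV b p N x₀ : ℚ) : ZMod p)) ∨
        (((orbitK b p N x : ℚ) : ZMod p) = (-1 : ZMod p) ^ (N + 1) * ((orbitK b p N x₀ : ℚ) : ZMod p) ∧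
          ((orbitV b p N x : ℚ) : ZMod p) = (-1 : ZMod p) ^ (N + 1) * ((orbitV b p N x₀ : ℚ) : ZMod p)) := by
      intro x hxD
      by_cases hxl : x ∈ ccLive b p N
      · exact Or.inr (orbit_cast_of_sameKey b hb hp5 hpb hwin hx₀D hxD (hrel x₀ hx₀ x hxl))
      · exact Or.inl (orbit_cast_eq_zero_of_not_live b hb hp5 hpb hwin hxD hxl)
    by_cases hz : ((orbitK b p N x₀ : ℚ) : ZMod p) = 0 ∧ ((orbitV b p N x₀ : ℚ) : ZMod p) = 0
    · refine ⟨1, 0, fun h => hone h.1, fun x hxD => pCong_line_of_cast b hb hp5 hwin 1 0 0 x ?_⟩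
      rcases hall x hxD with ⟨hk, -⟩ | ⟨hk, -⟩ | ⟨hk, -⟩ <;> rw [hk] <;> simp [hz.1]
    · refine ⟨((((orbitV b p N x₀ : ℚ) : ZMod p).val : ℕ) : ℤ), -((((orbitK b p N x₀ : ℚ) : ZMod p).val : ℕ) : ℤ),
        fun h => hz ?_, fun x hxD => pCong_line_of_cast b hb hp5 hwin _ _ 0 x ?_⟩
      · obtain ⟨h1, h2⟩ := h
        refine ⟨?_, ?_⟩
        · rw [← ev ((orbitK b p N x₀ : ℚ) : ZMod p)]; exact (ZMod.intCast_zmod_eq_zero_iff_dvd _ _).2 ((dvd_neg).1 h2)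
        · rw [← ev ((orbitV b p N x₀ : ℚ) : ZMod p)]; exact (ZMod.intCast_zmod_eq_zero_iff_dvd _ _).2 h1
      · rw [Int.cast_neg, ev, ev, Int.cast_zero, add_zero]
        rcases hall x hxD with ⟨hk, hv⟩ | ⟨hk, hv⟩ | ⟨hk, hv⟩ <;> rw [hk, hv] <;> ring
  · push Not at hlive
    refine ⟨1, 0, fun h => hone h.1, fun x hxD => pCong_line_of_cast b hb hp5 hwin 1 0 0 x ?_⟩
    have hx0 := orbit_cast_eq_zero_of_not_live b hb hp5 hpb hwin hxD (hlive x)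
    rw [hx0.1, hx0.2]; simp

/-- **`N` odd and `k = 2`: an affine line** (every deep class is live; orbit vectors take two values `P₁`, `P₂`). -/
theorem line_affine_of_ccCount_eq_two (hodd : N % 2 = 1) (hk : ccCount b p N = 2) :
    ∃ a c e : ℤ, ¬ ((p : ℤ) ∣ a ∧ (p : ℤ) ∣ c) ∧
      ∀ x ∈ deepClasses b p N, pCong p (a * orbitK b p N x + c * orbitV b p N x + e) = true := by
  classical
  have hprime := hp.out
  have hone : ¬ ((p : ℤ) ∣ 1) := fun h => by have := Int.le_of_dvd one_pos h; omega
  have ev : ∀ z : ZMod p, (((z.val : ℕ) : ℤ) : ZMod p) = z := fun z => by rw [Int.cast_natCast, ZMod.natCast_zmod_val]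
  have hs1 : (-1 : ZMod p) ^ (N + 1) = 1 := Even.neg_one_pow (Nat.odd_iff.2 hodd).add_one
  -- every deep class is live (`N` odd)
  have hlive : ∀ x ∈ deepClasses b p N, x ∈ ccLive b p N :=
    fun x hxD => mem_ccLive_iff.2 ⟨hxD, fun ⟨_, h2, _⟩ => by omega⟩
  -- two representatives
  unfold ccCount at hk
  obtain ⟨r₁, hr₁, r₂, hr₂, hcov⟩ := cover_two_of_keyCount_eq_two hk
  obtain ⟨x₁, hx₁, rfl⟩ := List.mem_map.1 hr₁
  obtain ⟨x₂, hx₂, rfl⟩ := List.mem_map.1 hr₂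
  have hx₁D : x₁ ∈ deepClasses b p N := (mem_ccLive_iff.1 hx₁).1
  have hx₂D : x₂ ∈ deepClasses b p N := (mem_ccLive_iff.1 hx₂).1
  -- name the two points
  obtain ⟨K₁, hK₁⟩ : ∃ K₁, ((orbitK b p N x₁ : ℚ) : ZMod p) = K₁ := ⟨_, rfl⟩
  obtain ⟨V₁, hV₁⟩ : ∃ V₁, ((orbitV b p N x₁ : ℚ) : ZMod p) = V₁ := ⟨_, rfl⟩
  obtain ⟨K₂, hK₂⟩ : ∃ K₂, ((orbitK b p N x₂ : ℚ) : ZMod p) = K₂ := ⟨_, rfl⟩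
  obtain ⟨V₂, hV₂⟩ : ∃ V₂, ((orbitV b p N x₂ : ℚ) : ZMod p) = V₂ := ⟨_, rfl⟩
  have hall : ∀ x ∈ deepClasses b p N,
      (((orbitK b p N x : ℚ) : ZMod p) = K₁ ∧ ((orbitV b p N x : ℚ) : ZMod p) = V₁) ∨
      (((orbitK b p N x : ℚ) : ZMod p) = K₂ ∧ ((orbitV b p N x : ℚ) : ZMod p) = V₂) := by
    intro x hxD
    rcases hcov _ (List.mem_map.2 ⟨x, hlive x hxD, rfl⟩) with h | h
    · rcases orbit_cast_of_sameKey b hb hp5 hpb hwin hx₁D hxD h with h' | h'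
      · rw [hK₁, hV₁] at h'; exact Or.inl h'
      · rw [hs1, one_mul, one_mul, hK₁, hV₁] at h'; exact Or.inl h'
    · rcases orbit_cast_of_sameKey b hb hp5 hpb hwin hx₂D hxD h with h' | h'
      · rw [hK₂, hV₂] at h'; exact Or.inr h'
      · rw [hs1, one_mul, one_mul, hK₂, hV₂] at h'; exact Or.inr h'
  by_cases heq : K₁ = K₂ ∧ V₁ = V₂
  · -- one point `P₁`: the line through the origin and `P₁`
    obtain ⟨heK, heV⟩ := heq
    by_cases hz : K₁ = 0 ∧ V₁ = 0
    · refine ⟨1, 0, 0, fun h => hone h.1, fun x hxD => pCong_line_of_cast b hb hp5 hwin 1 0 0 x ?_⟩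
      rcases hall x hxD with ⟨hk', -⟩ | ⟨hk', -⟩ <;> rw [hk'] <;> simp [hz.1, ← heK]
    · refine ⟨((V₁.val : ℕ) : ℤ), -((K₁.val : ℕ) : ℤ), 0, fun h => hz ?_, fun x hxD =>
        pCong_line_of_cast b hb hp5 hwin _ _ 0 x ?_⟩
      · obtain ⟨h1, h2⟩ := h
        refine ⟨?_, ?_⟩
        · rw [← ev K₁]; exact (ZMod.intCast_zmod_eq_zero_iff_dvd _ _).2 ((dvd_neg).1 h2)
        · rw [← ev V₁]; exact (ZMod.intCast_zmod_eq_zero_iff_dvd _ _).2 h1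
      · rw [Int.cast_neg, ev, ev, Int.cast_zero, add_zero]
        rcases hall x hxD with ⟨hk', hv'⟩ | ⟨hk', hv'⟩ <;> rw [hk', hv'] <;> [ring; (rw [← heK, ← heV]; ring)]
  · -- two distinct points: the affine line through them
    refine ⟨(((V₁ - V₂).val : ℕ) : ℤ), -(((K₁ - K₂).val : ℕ) : ℤ), (((K₁ * V₂ - V₁ * K₂).val : ℕ) : ℤ),
      fun h => heq ?_, fun x hxD => pCong_line_of_cast b hb hp5 hwin _ _ _ x ?_⟩
    · obtain ⟨h1, h2⟩ := h
      have h1' : V₁ - V₂ = 0 := by rw [← ev (V₁ - V₂)]; exact (ZMod.intCast_zmod_eq_zero_iff_dvd _ _).2 h1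
      have h2' : K₁ - K₂ = 0 := by rw [← ev (K₁ - K₂)]; exact (ZMod.intCast_zmod_eq_zero_iff_dvd _ _).2 ((dvd_neg).1 h2)
      exact ⟨sub_eq_zero.1 h2', sub_eq_zero.1 h1'⟩
    · rw [Int.cast_neg, ev, ev, ev]
      rcases hall x hxD with ⟨hk', hv'⟩ | ⟨hk', hv'⟩ <;> rw [hk', hv'] <;> ring

end Orbits

/-- **Census g17's `CCOrbitTypeCorollary`, verbatim** (the regime hypothesis `ccRegime` is not even needed for the line). -/
theorem ccOrbitTypeCorollary :
    ∀ (b : ℕ → ℤ) (p N : ℕ), InPolytope b → p.Prime → 5 ≤ p → (p : ℤ) ≤ b 0 → (p : ℤ) ≤ dOf b → (b 0 + 2 : ℤ) < (p : ℤ) ^ 2 → 3 ≤ N →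
      ccRegime b p N = true →
      (ccCount b p N ≤ 1 ∨ (N % 2 = 1 ∧ ccCount b p N = 2 ∧ ((N : ℤ) - 1) * p + 2 ≤ 2 * dOf b + 3)) →
      ∃ a c e : ℤ, ¬ ((p : ℤ) ∣ a ∧ (p : ℤ) ∣ c) ∧ (e = 0 ∨ ((N : ℤ) - 1) * p + 2 ≤ 2 * dOf b + 3) ∧
        ∀ x ∈ deepClasses b p N, pCong p (a * orbitK b p N x + c * orbitV b p N x + e) = true := by
  intro b p N hb hprime hp5 hpb _ hwin hN _ hk
  haveI : Fact p.Prime := ⟨hprime⟩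
  rcases hk with hk | ⟨hodd, hk, hrange⟩
  · obtain ⟨a, c, hac, h⟩ := line_origin_of_ccCount_le_one b hb hp5 hpb hwin hk
    exact ⟨a, c, 0, hac, Or.inl rfl, fun x hx => by simpa using h x hx⟩
  · obtain ⟨a, c, e, hac, h⟩ := line_affine_of_ccCount_eq_two b hb hp5 hpb hwin hodd hk
    exact ⟨a, c, e, hac, Or.inr hrange, h⟩


/-! ## §3  The rung licences -/

/-- **Rung O licence**: `ccGuard b p N = true` (census g17's structural guard of `CollinearityCriterion`) gives `casLB + 1 ≤ v_p(Cas_j(b))`. -/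
theorem casLB_succ_le_of_ccGuard (b : ℕ → ℤ) (p j N : ℕ) (hb : InPolytope b) (hb' : InPolytope (shift b j))
    (hj1 : 1 ≤ j) (hj7 : j ≤ 7) (hprime : p.Prime) (hp5 : 5 ≤ p) (hpb : (p : ℤ) ≤ b 0) (hpd : (p : ℤ) ≤ dOf b)
    (hwin : (b 0 + 2 : ℤ) < (p : ℤ) ^ 2) (H : ccGuard b p N = true) (hcas : casoratian b j ≠ 0) :
    casLB b p + 1 ≤ padicValRat p (casoratian b j) := by
  have H' := H
  simp only [ccGuard, Bool.and_eq_true, Bool.or_eq_true, decide_eq_true_eq, beq_iff_eq] at H'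
  have hR : ccRegime b p N = true := H'.1.1
  have hN : 3 ≤ N := H'.1.2
  have hk : ccCount b p N ≤ 1 ∨ (N % 2 = 1 ∧ ccCount b p N = 2 ∧ ((N : ℤ) - 1) * p + 2 ≤ 2 * dOf b + 3) :=
    H'.2.elim Or.inl (fun h => Or.inr ⟨h.1.1, h.1.2, h.2⟩)
  obtain ⟨h1, h2⟩ := of_decide_eq_true hR
  exact collinearityCriterion_holds b p j N hb hb' hj1 hj7 hprime hp5 hpb hpd hwin hN h1 h2
    (ccOrbitTypeCorollary b p N hb hprime hp5 hpb hpd hwin hN hR hk) hcas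

/-- **Rung X licence**: `ccGuardT b p N = true` (structural guard of `CollinearityCriterionT`, through-origin case) gives `casLB + 1 ≤ v_p(Cas_j(b))`. -/
theorem casLB_succ_le_of_ccGuardT (b : ℕ → ℤ) (p j N : ℕ) (hb : InPolytope b) (hb' : InPolytope (shift b j))
    (hj1 : 1 ≤ j) (hj7 : j ≤ 7) (hprime : p.Prime) (hp5 : 5 ≤ p) (hpb : (p : ℤ) ≤ b 0) (hpd : (p : ℤ) ≤ dOf b)
    (hwin : (b 0 + 2 : ℤ) < (p : ℤ) ^ 2) (H : ccGuardT b p N = true) (hcas : casoratian b j ≠ 0) :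
    casLB b p + 1 ≤ padicValRat p (casoratian b j) := by
  haveI : Fact p.Prime := ⟨hprime⟩
  have H' := H
  simp only [ccGuardT, Bool.and_eq_true, decide_eq_true_eq] at H'
  obtain ⟨⟨hR, hN⟩, hk⟩ := H'
  obtain ⟨h1, h2⟩ := of_decide_eq_true hR
  obtain ⟨a, c, hac, h⟩ := line_origin_of_ccCount_le_one b hb hp5 hpb hwin hk
  exact collinearityCriterionT_holds b p j N hb hb' hj1 hj7 hprime hp5 hpb hpd hwin hN h1 h2
    ⟨a, c, 0, hac, Or.inl rfl, fun x hx => by simpa using h x hx⟩ hcas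

end Summit.KontsevichZagierPeriods.Zeta5Search.ClusterValuation

end
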